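import Summits.SmoothPoincare4.SmoothPoincare4.Theorems.WeakReductionDescentDependentTripleGenusThreeStandardSketchReductionFive

/-!
# Crux `WeakReductionDescent.DependentTripleGenusThreeStandard` (stmt-SmoothPoincare4-18000), line
# `Sketch`, skeleton v6: the configuration-(2) stub with FIXED labels, and the reduction

Helper file (`--supports stmt-SmoothPoincare4-18000`), continuation of
`…SketchReductionFive.lean` (p167784, skeleton v5: crux ⇐ five stubs).  Skeleton v6
(`Cruxes/DependentTripleGenusThreeStandard/Lines/Sketch.lean`) fixes the labels in stub 3b: the
separating, non-parallel pair is `f 0 ⊂ H_0`-disc, `f 1 ⊂ H_1`-disc, i.e. Aranda–Zupan's Lemma 3.8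
(arXiv:2503.04607 p. 10) is needed for ONE Heegaard splitting, `H_0 ∪_F H_1 = ∂X_2 ≅ S¹ × S²`, only.
The general pair `i ≠ j` follows by RELABELLING THE SECTORS (`helper_sepPair_of_fixedLabels`:
a permutation `σ` with `σ 0 = i`, `σ 1 = j`; `IsGKTrisection.comp_perm`; the central surface is
fixed, the handlebody of `T ∘ σ` opposite `m` is the one of `T` opposite `σ m`, and weak
reducibility is invariant — `Literature.Barriers.SmoothPoincare4.Trisection.*_comp_perm`), and the
v6 REDUCTION `helper_dependentTripleGenusThreeStandard_of_five01` is the crux BY NAME from the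
five registered stubs of v6.  No definition, no named fact; pure logic over proved tree theorems.

Reference: R. Aranda, A. Zupan, arXiv:2503.04607 (2025), §7 pp. 24–25; Lemma 3.8 (p. 10).
-/

-- the registered namespace `Summit.SmoothPoincare4.SmoothPoincare4.Theorems…` repeats a component
set_option linter.dupNamespace false

noncomputable section

open scoped Manifold ContDiff Topology ContinuousMap
open Set
open Literature.Topology.FourManifolds
open Literature.Topology.FourManifolds.Trisection

namespace Summit.SmoothPoincare4.SmoothPoincare4.Theorems

/-- Existence of a relabelling of the three sectors sending `0 ↦ i`, `1 ↦ j` (`i ≠ j`). [folklore] -/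
theorem exists_perm_fin_three {i j : Fin 3} (hij : i ≠ j) :
    ∃ σ : Equiv.Perm (Fin 3), σ 0 = i ∧ σ 1 = j := by
  revert i j
  decide

/-- **Relabelling (PROVED glue): the fixed-label form of stub 3b implies the form for every pair
`i ≠ j`** — relabel the sectors by a permutation `σ` with `σ 0 = i`, `σ 1 = j`
(`IsGKTrisection.comp_perm`; the central surface is fixed, the handlebody of `T ∘ σ` opposite `m`
is the one of `T` opposite `σ m`, and weak reducibility is invariant:
`Literature.Barriers.SmoothPoincare4.Trisection.*_comp_perm`). [folklore] -/
theorem helper_sepPair_of_fixedLabels :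
    (∀ (M : Type) [TopologicalSpace M] [T2Space M] [SecondCountableTopology M]
      [ChartedSpace (EuclideanSpace ℝ (Fin 4)) M] [IsManifold (𝓡 4) ∞ M],
      M ≃ₕ (Metric.sphere (0 : EuclideanSpace ℝ (Fin 5)) 1) → ∀ T : Fin 3 → Set M, IsGKTrisection M 3 (fun _ => 1) T →
      ∀ f : Fin 3 → Set M,
      (∀ i, IsCurve T (f i)) → (Pairwise fun i j => Disjoint (f i) (f j)) →
      (∀ i, IsNonSeparating T (f i)) → (∀ i, BoundsDisc T (spineHandlebody T i) (f i)) →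
      ¬ IsPreconnected (centralSurfaceSet T \ ⋃ i, f i) →
      ¬ IsConnected (centralSurfaceSet T \ (f 0 ∪ f 1)) →
      ¬ (∃ (ψ : EuclideanSpace ℝ (Fin 2) → M) (rlo r₀ r₁ rhi : ℝ),
        0 < r₀ ∧ 0 < r₁ ∧ rlo < r₀ ∧ rlo < r₁ ∧ r₀ < rhi ∧ r₁ < rhi ∧
        ContMDiffOn (𝓡 2) (𝓡 4) ∞ ψ {x | rlo < ‖x‖ ∧ ‖x‖ < rhi} ∧
        Set.InjOn ψ {x | rlo < ‖x‖ ∧ ‖x‖ < rhi} ∧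
        (∀ x : EuclideanSpace ℝ (Fin 2), rlo < ‖x‖ → ‖x‖ < rhi →
          Function.Injective (mfderiv (𝓡 2) (𝓡 4) ψ x)) ∧
        ψ '' {x | rlo < ‖x‖ ∧ ‖x‖ < rhi} ⊆ centralSurfaceSet T ∧
        (Set.range fun x : Metric.sphere (0 : EuclideanSpace ℝ (Fin 2)) 1 =>
          ψ (r₀ • (x : EuclideanSpace ℝ (Fin 2)))) = f 0 ∧
        (Set.range fun x : Metric.sphere (0 : EuclideanSpace ℝ (Fin 2)) 1 =>
          ψ (r₁ • (x : EuclideanSpace ℝ (Fin 2)))) = f 1) →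
      IsWeaklyReducible T) →
    ∀ (M : Type) [TopologicalSpace M] [T2Space M] [SecondCountableTopology M]
      [ChartedSpace (EuclideanSpace ℝ (Fin 4)) M] [IsManifold (𝓡 4) ∞ M],
      M ≃ₕ (Metric.sphere (0 : EuclideanSpace ℝ (Fin 5)) 1) → ∀ T : Fin 3 → Set M, IsGKTrisection M 3 (fun _ => 1) T →
      ∀ f : Fin 3 → Set M,
      (∀ i, IsCurve T (f i)) → (Pairwise fun i j => Disjoint (f i) (f j)) →
      (∀ i, IsNonSeparating T (f i)) → (∀ i, BoundsDisc T (spineHandlebody T i) (f i)) →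
      ¬ IsPreconnected (centralSurfaceSet T \ ⋃ i, f i) →
      ∀ i j : Fin 3, i ≠ j → ¬ IsConnected (centralSurfaceSet T \ (f i ∪ f j)) →
      ¬ (∃ (ψ : EuclideanSpace ℝ (Fin 2) → M) (rlo r₀ r₁ rhi : ℝ),
        0 < r₀ ∧ 0 < r₁ ∧ rlo < r₀ ∧ rlo < r₁ ∧ r₀ < rhi ∧ r₁ < rhi ∧
        ContMDiffOn (𝓡 2) (𝓡 4) ∞ ψ {x | rlo < ‖x‖ ∧ ‖x‖ < rhi} ∧
        Set.InjOn ψ {x | rlo < ‖x‖ ∧ ‖x‖ < rhi} ∧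
        (∀ x : EuclideanSpace ℝ (Fin 2), rlo < ‖x‖ → ‖x‖ < rhi →
          Function.Injective (mfderiv (𝓡 2) (𝓡 4) ψ x)) ∧
        ψ '' {x | rlo < ‖x‖ ∧ ‖x‖ < rhi} ⊆ centralSurfaceSet T ∧
        (Set.range fun x : Metric.sphere (0 : EuclideanSpace ℝ (Fin 2)) 1 =>
          ψ (r₀ • (x : EuclideanSpace ℝ (Fin 2)))) = f i ∧
        (Set.range fun x : Metric.sphere (0 : EuclideanSpace ℝ (Fin 2)) 1 =>
          ψ (r₁ • (x : EuclideanSpace ℝ (Fin 2)))) = f j) →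
      IsWeaklyReducible T := by
  intro h01 M _ _ _ _ _ e T hT f hcur hdis hns hbd hdep i j hij hsep hA
  obtain ⟨σ, h0, h1⟩ := exists_perm_fin_three hij
  -- relabel the sectors by `σ` and the curves accordingly
  have hT' : IsGKTrisection M 3 (fun _ => 1) (T ∘ σ) := hT.comp_perm σ
  have hF : centralSurfaceSet (T ∘ σ) = centralSurfaceSet T :=
    Literature.Barriers.SmoothPoincare4.Trisection.centralSurfaceSet_comp_perm T σ
  have hcur' : ∀ m, IsCurve (T ∘ σ) ((f ∘ σ) m) := fun m =>
    (Literature.Barriers.SmoothPoincare4.Trisection.isCurve_comp_perm T σ _).2 (hcur (σ m))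
  have hdis' : Pairwise fun m m' => Disjoint ((f ∘ σ) m) ((f ∘ σ) m') :=
    fun m m' hmm' => hdis (σ.injective.ne hmm')
  have hns' : ∀ m, IsNonSeparating (T ∘ σ) ((f ∘ σ) m) := fun m =>
    (Literature.Barriers.SmoothPoincare4.Trisection.isNonSeparating_comp_perm T σ _).2 (hns (σ m))
  have hbd' : ∀ m, BoundsDisc (T ∘ σ) (spineHandlebody (T ∘ σ) m) ((f ∘ σ) m) := fun m => by
    rw [Literature.Barriers.SmoothPoincare4.Trisection.spineHandlebody_comp_perm,
      Literature.Barriers.SmoothPoincare4.Trisection.boundsDisc_comp_perm]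
    exact hbd (σ m)
  have hU : (⋃ m, (f ∘ σ) m) = ⋃ m, f m := σ.surjective.iUnion_comp f
  have hdep' : ¬ IsPreconnected (centralSurfaceSet (T ∘ σ) \ ⋃ m, (f ∘ σ) m) := by
    rwa [hF, hU]
  have hsep' : ¬ IsConnected (centralSurfaceSet (T ∘ σ) \ ((f ∘ σ) 0 ∪ (f ∘ σ) 1)) := by
    simpa only [hF, Function.comp_apply, h0, h1] using hsep
  have hA' : ¬ (∃ (ψ : EuclideanSpace ℝ (Fin 2) → M) (rlo r₀ r₁ rhi : ℝ),
        0 < r₀ ∧ 0 < r₁ ∧ rlo < r₀ ∧ rlo < r₁ ∧ r₀ < rhi ∧ r₁ < rhi ∧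
        ContMDiffOn (𝓡 2) (𝓡 4) ∞ ψ {x | rlo < ‖x‖ ∧ ‖x‖ < rhi} ∧
        Set.InjOn ψ {x | rlo < ‖x‖ ∧ ‖x‖ < rhi} ∧
        (∀ x : EuclideanSpace ℝ (Fin 2), rlo < ‖x‖ → ‖x‖ < rhi →
          Function.Injective (mfderiv (𝓡 2) (𝓡 4) ψ x)) ∧
        ψ '' {x | rlo < ‖x‖ ∧ ‖x‖ < rhi} ⊆ centralSurfaceSet (T ∘ σ) ∧
        (Set.range fun x : Metric.sphere (0 : EuclideanSpace ℝ (Fin 2)) 1 =>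
          ψ (r₀ • (x : EuclideanSpace ℝ (Fin 2)))) = (f ∘ σ) 0 ∧
        (Set.range fun x : Metric.sphere (0 : EuclideanSpace ℝ (Fin 2)) 1 =>
          ψ (r₁ • (x : EuclideanSpace ℝ (Fin 2)))) = (f ∘ σ) 1) := by
    simpa only [hF, Function.comp_apply, h0, h1] using hA
  have hwr := h01 M e (T ∘ σ) hT' (f ∘ σ) hcur' hdis' hns' hbd' hdep' hsep' hA'
  exact (Literature.Barriers.SmoothPoincare4.Trisection.isWeaklyReducible_comp_perm T σ).1 hwr


/-- **REGISTERED helper — THE REDUCTION OF THE LINE, skeleton v6 (crux ⇐ five stubs, labels of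
stub 3b fixed; sorry-free).**  Hypotheses, verbatim the five registered stubs of v6: (1) the
Thm. 1.3 fact (= sibling item `GenusThreeBase`); (2) `msz_trisection_classification_gk.{0}`;
(3a) disc transport across an annular chart; (3b) configuration (2) for the pair
`f 0 ⊂ H_0`, `f 1 ⊂ H_1` ⇒ weakly reducible; (4) the loop-partner step.  Proof:
`helper_dependentTripleGenusThreeStandard_of_five` (p167784) with (3b) generalised to all pairs by
`helper_sepPair_of_fixedLabels`.
[cite: ArandaZupan2025, Thm. 1.3, Thm. 1.4 and Cor. 1.5 (p. 2), §7 (pp. 24–26)] [cite: MeierSchirmerZupan2016, Thm. 1.2] -/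
theorem helper_dependentTripleGenusThreeStandard_of_five01 :
    Literature.Barriers.SmoothPoincare4.az2025_weaklyReducible_genusThree_homotopySphere_gk.{0} →
    msz_trisection_classification_gk.{0} →
    (∀ (M : Type) [TopologicalSpace M] [T2Space M] [SecondCountableTopology M] [ChartedSpace (EuclideanSpace ℝ (Fin 4)) M] [IsManifold (𝓡 4) ∞ M], ∀ (g : ℕ) (k : Fin 3 → ℕ) (T : Fin 3 → Set M), IsGKTrisection M g k T → ∀ (p : Fin 3) (a b : Set M), IsCurve T a → IsCurve T b → (∃ (ψ : EuclideanSpace ℝ (Fin 2) → M) (rlo r₀ r₁ rhi : ℝ), 0 < r₀ ∧ 0 < r₁ ∧ rlo < r₀ ∧ rlo < r₁ ∧ r₀ < rhi ∧ r₁ < rhi ∧ ContMDiffOn (𝓡 2) (𝓡 4) ∞ ψ {x | rlo < ‖x‖ ∧ ‖x‖ < rhi} ∧ Set.InjOn ψ {x | rlo < ‖x‖ ∧ ‖x‖ < rhi} ∧ (∀ x : EuclideanSpace ℝ (Fin 2), rlo < ‖x‖ → ‖x‖ < rhi → Function.Injective (mfderiv (𝓡 2) (𝓡 4) ψ x)) ∧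 ψ '' {x | rlo < ‖x‖ ∧ ‖x‖ < rhi} ⊆ centralSurfaceSet T ∧ (Set.range fun x : Metric.sphere (0 : EuclideanSpace ℝ (Fin 2)) 1 => ψ (r₀ • (x : EuclideanSpace ℝ (Fin 2)))) = a ∧ (Set.range fun x : Metric.sphere (0 : EuclideanSpace ℝ (Fin 2)) 1 => ψ (r₁ • (x : EuclideanSpace ℝ (Fin 2)))) = b) → BoundsDisc T (spineHandlebody T p) a → BoundsDisc T (spineHandlebody T p) b) →
    (∀ (M : Type) [TopologicalSpace M] [T2Space M] [SecondCountableTopology M] [ChartedSpace (EuclideanSpace ℝ (Fin 4)) M] [IsManifold (𝓡 4) ∞ M], M ≃ₕ (Metric.sphere (0 : EuclideanSpace ℝ (Fin 5)) 1) → ∀ T : Fin 3 → Set M, IsGKTrisection M 3 (fun _ => 1) T → ∀ f : Fin 3 → Set M, (∀ i, IsCurve T (f i)) → (Pairwise fun i j => Disjoint (f i) (f j)) → (∀ i, IsNonSeparating T (f i)) → (∀ i, BoundsDisc T (spineHandlebody T i) (f i)) → ¬ IsPreconnected (centralSurfaceSet T \ ⋃ i, f i) → ¬ IsConnected (centralSurfaceSet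 T \ (f 0 ∪ f 1)) → ¬ (∃ (ψ : EuclideanSpace ℝ (Fin 2) → M) (rlo r₀ r₁ rhi : ℝ), 0 < r₀ ∧ 0 < r₁ ∧ rlo < r₀ ∧ rlo < r₁ ∧ r₀ < rhi ∧ r₁ < rhi ∧ ContMDiffOn (𝓡 2) (𝓡 4) ∞ ψ {x | rlo < ‖x‖ ∧ ‖x‖ < rhi} ∧ Set.InjOn ψ {x | rlo < ‖x‖ ∧ ‖x‖ < rhi} ∧ (∀ x : EuclideanSpace ℝ (Fin 2), rlo < ‖x‖ → ‖x‖ < rhi → Function.Injective (mfderiv (𝓡 2) (𝓡 4) ψ x)) ∧ ψ '' {x | rlo < ‖x‖ ∧ ‖x‖ < rhi} ⊆ centralSurfaceSet T ∧ (Set.range fun x : Metric.sphere (0 : EuclideanSpace ℝ (Fin 2)) 1 => ψ (r₀ • (x : EuclideanSpace ℝ (Fin 2)))) = f 0 ∧ (Set.range fun x : Metric.sphere (0 : EuclideanSpace ℝ (Fin 2)) 1 => ψ (r₁ • (x : EuclideanSpace ℝ (Fin 2)))) = f 1) → IsWeaklyReducible T) →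
    (∀ (M : Type) [TopologicalSpace M] [T2Space M] [SecondCountableTopology M] [ChartedSpace (EuclideanSpace ℝ (Fin 4)) M] [IsManifold (𝓡 4) ∞ M], M ≃ₕ (Metric.sphere (0 : EuclideanSpace ℝ (Fin 5)) 1) → ∀ T : Fin 3 → Set M, IsGKTrisection M 3 (fun _ => 1) T → ∀ f : Fin 3 → Set M, ((∀ i, IsCurve T (f i)) ∧ (Pairwise fun i j => Disjoint (f i) (f j)) ∧ (∀ i, IsNonSeparating T (f i)) ∧ (∀ i, BoundsDisc T (spineHandlebody T i) (f i)) ∧ (∀ i j, i ≠ j → IsConnected (centralSurfaceSet T \ (f i ∪ f j))) ∧ ¬ IsPreconnected (centralSurfaceSet T \ ⋃ i, f i)) → ¬ IsWeaklyReducible T → ∃ (X' : Type) (_ : TopologicalSpace X') (_ : T2Space X') (_ : SecondCountableTopology X') (_ : ChartedSpace (EuclideanSpace ℝ (Fin 4)) X') (_ : IsManifold (𝓡 4) ∞ X') (g' : ℕ) (k' : Fin 3 → ℕ) (T' : Fin 3 → Set X') (ℓ : Metric.sphere (0 : EuclideanSpace ℝ (Fin 2)) 1 → X'), g' ≤ 2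 ∧ IsGKTrisection X' g' k' T' ∧ IsCircleSurgery (𝓡 4) (𝓡 4) X' M ℓ) →
    Summit.SmoothPoincare4.SmoothPoincare4.Theses.WeakReductionDescent.DependentTripleGenusThreeStandard := by
  intro h1 h2 h3a h3b h4
  exact helper_dependentTripleGenusThreeStandard_of_five h1 h2 h3a (helper_sepPair_of_fixedLabels h3b) h4

end Summit.SmoothPoincare4.SmoothPoincare4.Theorems

end
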